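import Summits.BirchSwinnertonDyer.BirchSwinnertonDyer.Theorems.ThetaPartnerAtTwoSignedControlAtTwoDivOfPoitouTateTotallyReal
import Summits.BirchSwinnertonDyer.BirchSwinnertonDyer.Theorems.ThetaPartnerAtTwoSignedControlAtTwoShaTwoPrimaryVanishingOdd
import Summits.BirchSwinnertonDyer.BirchSwinnertonDyer.Theorems.ThetaPartnerAtTwoSignedControlAtTwoShaTwoPrimaryVanishingTotallyComplex
import Summits.BirchSwinnertonDyer.BirchSwinnertonDyer.Theorems.ThetaPartnerAtTwoSignedControlAtTwoShaThreeBaseH3Units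
import Summits.BirchSwinnertonDyer.BirchSwinnertonDyer.Theorems.ThetaPartnerAtTwoSignedControlAtTwoStubPoitouTateShaRat
import HarnessLib

/-!
# `Ш²(K, E[p^∞]) = 0`, DIV «`(γ−1)·H¹(K_∞, E[p^∞]) = H¹(K_∞, E[p^∞])`» and «no nonzero finite `Λ`-submodule in the dual»
# — UNCONDITIONAL, for: `K` totally real (every `p`), any `K` with `p` odd, `K` totally complex (every `p`)

Seat `bsd-inputs-k4-p1` (gen 3; LADDER-BSD D-0154 KEY (147)(f) «prove the printed input», row 1 K4 INPUTS; `--supports`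
stmt-BirchSwinnertonDyer-20309). THEOREMS ONLY (no definition, no named fact, no `sorry`); ROUTE-FREE (no `Theses/*.lean` in
the import closure). Nothing is restated: every statement below is a declaration of this lineage's earlier files
(`…ShaTwoPrimaryVanishingOdd` g1 p617570, `…ShaTwoPrimaryVanishingTotallyComplex` g0-0 p627308, `…DivOfPoitouTateTotallyReal`
g1) applied BY NAME with its Poitou–Tate hypotheses discharged.

## What changed on 2026-08-28

Those files proved, for an elliptic curve `E = W` over a number field `K`, a prime `p`, `Sel_{p^∞}(E/K)` finite and
`E(K)[p] = 0`: `Ш²(K, E[p^∞]) = 0`; hence (this lineage's `…DivOfShaTwoAnyField`) along EVERY `ℤ_p`-extension `κ` with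
topological generator `γ` every class of `H¹(Gal(K̄/K_∞), E[p^∞])` is `conj_γ t − t` («DIV», the input Greenberg's Prop. 4.12
supplies to the control arguments, LNM 1716 p. 119); hence (`…NoFiniteSubmoduleOfShaTwo`) the Pontryagin dual of
`H¹(K_∞, E[p^∞])` has no nonzero finite `Λ`-submodule (the CONCLUSION of Greenberg's Prop. 4.9 / 4.12 for the full group) —
MODULO the generic Poitou–Tate rows taken as hypotheses by name: `poitouTate_sha_tateDual K` (Milne I 4.10 (a); odd `p`:
this alone; totally complex `K`: this alone) and, for totally real `K` at `p = 2`, `poitouTate_three_realPlaces_injective K`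
(4.10 (c), `r = 3`) and `poitouTate_two_realPlaces_surjective K` (Cor. 4.16). All three rows are now THEOREMS for every number
field: `SignedEC.PoitouTateShaRat.poitouTate_sha_tateDual_numberField` (k4-p1 g0-0 p629917 on cell bsd-schneider's doors
c4/c5 and bsd-wall chl-p2), `SignedEC.ShaThreeBrauer.poitouTate_three_realPlaces_injective_holds` (w3 g9 p628282 on the
lead's dévissage), `GaloisCohomology.poitouTate_two_realPlaces_surjective_holds` (w2 g6 p618871). This file discharges them:

* §1 totally real `K` (in particular `K = ℚ`), EVERY prime `p` (including `p = 2`): `forall_mem_shaTwo_primary_eq_zero_real`,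
  `shaTwo_primary_eq_bot_real`, `forall_exists_conjH1_sub_eq_real` (DIV), `dual_forall_finite_eq_bot_real`;
* §2 any number field `K`, `p` odd: `…_odd` (same four);
* §3 totally complex `K`, every `p`: `…_complex` (same four).

Remaining hypotheses are the printed-type ones only: `Sel_{p^∞}(E/K)` finite and `E(K)[p] = 0` (resp. `E[p^∞]^{Γ_K} = 0`).

## Honest framing

UNCONDITIONAL theorems (standard axioms) but COMPOSITIONS: the mathematics is in the cited files of the K4 line (lead
bsd-wall-tp2-p3, width seats w2/w3, this lineage) and of cell bsd-schneider; this file only applies them by name. These are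
NOT Greenberg's Prop. 4.9 / 4.12 as printed (those concern `H¹(F_Σ/F_∞, E[p^∞])` under a `Λ`-corank hypothesis and need
`H²(Gal(F_Σ/F), Hom(Λ, E[p^∞]))`, absent from the tree): they are the same CONCLUSIONS for the full group `H¹(K_∞, E[p^∞])`
in the `Sel_{p^∞}(E/K)`-finite, `E(K)[p] = 0` regime, from finite-level Poitou–Tate. No item is closed; no crux and no
summit statement is proved by this seat; the Birch–Swinnerton-Dyer conjecture is NOT proved by any of this.

References: [MilneADT2006] I Thm. 4.10 (a),(c), Cor. 4.16, Thm. 6.13 (c); [GreenbergLNM1716] §4 Appendix Prop. 4.9, 4.10,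
4.12 (pp. 113–119); [SerreGaloisCohomology1997] II §4.4 Prop. 13; [Washington1997] §13.2.
-/

set_option autoImplicit false
-- the Theorems namespace of this sub repeats the summit name by design (D-0017 nested layout)
set_option linter.dupNamespace false

noncomputable section

open scoped Classical NumberField

namespace Summit.BirchSwinnertonDyer.BirchSwinnertonDyer.Theorems.SignedEC.PrimaryTorsionH2

open Function NumberField IsDedekindDomain Field WeierstrassCurve
open Literature.NumberTheory.EllipticCurves Literature.NumberTheory.GaloisRepresentations
  Literature.NumberTheory.GaloisCohomology Literature.NumberTheory.EllipticCurves.IwasawaAlgebra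
open Literature.NumberTheory.GaloisRepresentations.DiscreteGaloisModule (shaTwo)
open Summit.BirchSwinnertonDyer.Rank1Residual.X11b

/-! ## §1 Totally real `K` (e.g. `K = ℚ`), every prime `p` -/

section TotallyReal

variable {K : Type} [Field K] [NumberField K] [IsTotallyReal K] (W : WeierstrassCurve K) [W.IsElliptic]
  (p : ℕ) [hp : Fact p.Prime]

/-- **`Ш²(K, E[p^∞]) = 0` for `K` totally real, EVERY prime `p`, `Sel_{p^∞}(E/K)` finite, `E[p^∞]^{Γ_K} = 0` — UNCONDITIONAL**:
this lineage's `forall_mem_shaTwo_primary_eq_zero_of_poitouTate` with its three Poitou–Tate rows discharged by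
`poitouTate_sha_tateDual_numberField`, `poitouTate_three_realPlaces_injective_holds`, `poitouTate_two_realPlaces_surjective_holds`.
[cite: MilneADT2006, Ch. I, Thm. 4.10 (a),(c), Cor. 4.16, Thm. 6.13 (c)] -/
theorem forall_mem_shaTwo_primary_eq_zero_real [Finite (W.selmerGroupPInfty p)]
    (hΓ : ∀ Q : W.geomPrimaryTorsion p,
      (∀ σ : absoluteGaloisGroup K, LocBridge.primaryGaloisModule W p σ Q = Q) → Q = 0) :
    ∀ c ∈ shaTwo (LocBridge.primaryGaloisModule W p), c = 0 :=
  forall_mem_shaTwo_primary_eq_zero_of_poitouTate W p (SignedEC.PoitouTateShaRat.poitouTate_sha_tateDual_numberField K)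
    (SignedEC.ShaThreeBrauer.poitouTate_three_realPlaces_injective_holds K) (poitouTate_two_realPlaces_surjective_holds K) hΓ

/-- **`Ш²(K, E[p^∞]) = ⊥` for `K` totally real, every `p`, `Sel_{p^∞}(E/K)` finite and `E(K)[p] = 0`** (as
`hK : ∀ P, p • P = 0 → P = 0`) — UNCONDITIONAL. [cite: MilneADT2006, Ch. I, Thm. 4.10 (a),(c), Cor. 4.16, Thm. 6.13 (c)] -/
theorem shaTwo_primary_eq_bot_real [Finite (W.selmerGroupPInfty p)] (hK : ∀ P : W.toAffine.Point, p • P = 0 → P = 0) :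
    shaTwo (LocBridge.primaryGaloisModule W p) = ⊥ :=
  shaTwo_primary_eq_bot_of_poitouTate W p (SignedEC.PoitouTateShaRat.poitouTate_sha_tateDual_numberField K)
    (SignedEC.ShaThreeBrauer.poitouTate_three_realPlaces_injective_holds K) (poitouTate_two_realPlaces_surjective_holds K) hK

variable (κ : ZpExtension K p) {γ : absoluteGaloisGroup K}

/-- **DIV for `K` totally real, every `p` — UNCONDITIONAL**: for every `ℤ_p`-extension `κ` of a totally real `K`,
topological generator `γ`, and elliptic `W/K` with `Sel_{p^∞}(E/K)` finite and `E(K)[p] = 0`, every class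
`s ∈ H¹(Gal(K̄/K_∞), E[p^∞])` is `conj_γ t − t` — the «(γ−1)-divisibility» that Greenberg's Prop. 4.12 supplies on p. 119
(`hdiv` of the ambient-coinvariant doors of K4 / 19097), with NO Greenberg-1999 / Kato input and no hypothesis left but
the two printed-type ones. [cite: GreenbergLNM1716, §4 Appendix Prop. 4.10, Prop. 4.12 (pp. 116–119)]
[cite: MilneADT2006, Ch. I, Thm. 4.10, Cor. 4.16, Thm. 6.13 (c)] -/
theorem forall_exists_conjH1_sub_eq_real (hγ : κ.IsTopGenerator γ) [Finite (W.selmerGroupPInfty p)]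
    (hK : ∀ P : W.toAffine.Point, p • P = 0 → P = 0) (s : W.subgroupH1 p κ.kerSubgroup) :
    ∃ t : W.subgroupH1 p κ.kerSubgroup, W.conjH1 p κ.kerSubgroup γ t - t = s :=
  forall_exists_conjH1_sub_eq_of_poitouTate W p κ hγ (SignedEC.PoitouTateShaRat.poitouTate_sha_tateDual_numberField K)
    (SignedEC.ShaThreeBrauer.poitouTate_three_realPlaces_injective_holds K) (poitouTate_two_realPlaces_surjective_holds K)
    hK s

/-- **No nonzero finite `Λ`-submodule in the Pontryagin dual of `H¹(K_∞, E[p^∞])`, `K` totally real, every `p` —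
UNCONDITIONAL** (the conclusion of Greenberg's Prop. 4.9 / 4.12 for the full group `H¹(Gal(K̄/K_∞), E[p^∞])`, in the
`Sel_{p^∞}(E/K)`-finite, `E(K)[p] = 0` regime): for every `Λ`-module `Y` mapped injectively into `Hom(H¹(K_∞, E[p^∞]), ℚ/ℤ)`
with `T` acting as `conj_γ − 1`. [cite: GreenbergLNM1716, §4 Appendix Prop. 4.9 (p. 113), Prop. 4.12 (p. 119)]
[cite: Washington1997, §13.2] -/
theorem dual_forall_finite_eq_bot_real (hγ : κ.IsTopGenerator γ) [Finite (W.selmerGroupPInfty p)]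
    (hK : ∀ P : W.toAffine.Point, p • P = 0 → P = 0)
    {Y : Type*} [AddCommGroup Y] [Module (IwasawaAlgebra p) Y]
    (dY : Y →+ (W.subgroupH1 p κ.kerSubgroup →+ AddCircle (1 : ℚ))) (hinj : Function.Injective dY)
    (hT : ∀ (y : Y) (x : W.subgroupH1 p κ.kerSubgroup),
      dY ((PowerSeries.X : IwasawaAlgebra p) • y) x = dY y (W.conjH1 p κ.kerSubgroup γ x) - dY y x) :
    ∀ N : Submodule (IwasawaAlgebra p) Y, Finite N → N = ⊥ :=
  dual_forall_finite_eq_bot_of_poitouTate W p κ hγ (SignedEC.PoitouTateShaRat.poitouTate_sha_tateDual_numberField K)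
    (SignedEC.ShaThreeBrauer.poitouTate_three_realPlaces_injective_holds K) (poitouTate_two_realPlaces_surjective_holds K)
    hK dY hinj hT

end TotallyReal

/-! ## §2 Any number field `K`, `p` odd -/

section Odd

variable {K : Type} [Field K] [NumberField K] (W : WeierstrassCurve K) [W.IsElliptic] (p : ℕ) [hp : Fact p.Prime]

/-- **`Ш²(K, E[p^∞]) = 0`, `p` odd, ANY number field `K`, `Sel_{p^∞}(E/K)` finite, `E[p^∞]^{Γ_K} = 0` — UNCONDITIONAL**:
this lineage's `forall_mem_shaTwo_primary_eq_zero_of_ne_two` (p617570: Poitou–Tate (a) + `cd_p(Γ_K) ≤ 2`) with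
`poitouTate_sha_tateDual K` discharged. [cite: MilneADT2006, Ch. I, Thm. 4.10 (a)] [cite: SerreGaloisCohomology1997, II §4.4 Prop. 13] -/
theorem forall_mem_shaTwo_primary_eq_zero_odd (hp2 : p ≠ 2) [Finite (W.selmerGroupPInfty p)]
    (hΓ : ∀ Q : W.geomPrimaryTorsion p,
      (∀ σ : absoluteGaloisGroup K, LocBridge.primaryGaloisModule W p σ Q = Q) → Q = 0) :
    ∀ c ∈ shaTwo (LocBridge.primaryGaloisModule W p), c = 0 :=
  forall_mem_shaTwo_primary_eq_zero_of_ne_two W p hp2 (SignedEC.PoitouTateShaRat.poitouTate_sha_tateDual_numberField K) hΓ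

/-- **`Ш²(K, E[p^∞]) = ⊥`, `p` odd, any number field, `Sel_{p^∞}(E/K)` finite, `E(K)[p] = 0` — UNCONDITIONAL.**
[cite: MilneADT2006, Ch. I, Thm. 4.10 (a)] [cite: SerreGaloisCohomology1997, II §4.4 Prop. 13] -/
theorem shaTwo_primary_eq_bot_odd (hp2 : p ≠ 2) [Finite (W.selmerGroupPInfty p)]
    (hK : ∀ P : W.toAffine.Point, p • P = 0 → P = 0) :
    shaTwo (LocBridge.primaryGaloisModule W p) = ⊥ :=
  shaTwo_primary_eq_bot_of_ne_two W p hp2 (SignedEC.PoitouTateShaRat.poitouTate_sha_tateDual_numberField K) hK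

variable (κ : ZpExtension K p) {γ : absoluteGaloisGroup K}

/-- **DIV at an odd prime, every number field — UNCONDITIONAL**: for every `ℤ_p`-extension `κ` of `K` (`p ≠ 2`),
topological generator `γ`, and elliptic `W/K` with `Sel_{p^∞}(E/K)` finite and `E(K)[p] = 0`, every class
`s ∈ H¹(Gal(K̄/K_∞), E[p^∞])` is `conj_γ t − t`. [cite: GreenbergLNM1716, §4 Appendix Prop. 4.10, Prop. 4.12 (pp. 116–119)]
[cite: MilneADT2006, Ch. I, Thm. 4.10 (a)] -/
theorem forall_exists_conjH1_sub_eq_odd (hp2 : p ≠ 2) (hγ : κ.IsTopGenerator γ) [Finite (W.selmerGroupPInfty p)]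
    (hK : ∀ P : W.toAffine.Point, p • P = 0 → P = 0) (s : W.subgroupH1 p κ.kerSubgroup) :
    ∃ t : W.subgroupH1 p κ.kerSubgroup, W.conjH1 p κ.kerSubgroup γ t - t = s :=
  forall_exists_conjH1_sub_eq_of_ne_two W p κ hp2 hγ (SignedEC.PoitouTateShaRat.poitouTate_sha_tateDual_numberField K) hK s

/-- **No nonzero finite `Λ`-submodule in the Pontryagin dual of `H¹(K_∞, E[p^∞])` at an odd prime, every number field —
UNCONDITIONAL** (Greenberg's Prop. 4.9 / 4.12 conclusion for the full group, `Sel_{p^∞}(E/K)` finite, `E(K)[p] = 0`).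
[cite: GreenbergLNM1716, §4 Appendix Prop. 4.9 (p. 113), Prop. 4.12 (p. 119)] [cite: Washington1997, §13.2] -/
theorem dual_forall_finite_eq_bot_odd (hp2 : p ≠ 2) (hγ : κ.IsTopGenerator γ) [Finite (W.selmerGroupPInfty p)]
    (hK : ∀ P : W.toAffine.Point, p • P = 0 → P = 0)
    {Y : Type*} [AddCommGroup Y] [Module (IwasawaAlgebra p) Y]
    (dY : Y →+ (W.subgroupH1 p κ.kerSubgroup →+ AddCircle (1 : ℚ))) (hinj : Function.Injective dY)
    (hT : ∀ (y : Y) (x : W.subgroupH1 p κ.kerSubgroup),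
      dY ((PowerSeries.X : IwasawaAlgebra p) • y) x = dY y (W.conjH1 p κ.kerSubgroup γ x) - dY y x) :
    ∀ N : Submodule (IwasawaAlgebra p) Y, Finite N → N = ⊥ :=
  dual_forall_finite_eq_bot_of_ne_two W p κ hp2 hγ (SignedEC.PoitouTateShaRat.poitouTate_sha_tateDual_numberField K)
    hK dY hinj hT

end Odd

/-! ## §3 Totally complex `K`, every prime `p` -/

section TotallyComplex

variable {K : Type} [Field K] [NumberField K] [IsTotallyComplex K] (W : WeierstrassCurve K) [W.IsElliptic]
  (p : ℕ) [hp : Fact p.Prime]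

/-- **`Ш²(K, E[p^∞]) = 0` for `K` totally complex, EVERY `p`, `Sel_{p^∞}(E/K)` finite, `E[p^∞]^{Γ_K} = 0` — UNCONDITIONAL**:
this lineage's `forall_mem_shaTwo_primary_eq_zero_of_isTotallyComplex` (p627308) with `poitouTate_sha_tateDual K` discharged.
[cite: MilneADT2006, Ch. I, Thm. 4.10 (a), Thm. 6.13 (c)] [cite: SerreGaloisCohomology1997, II §4.4 Prop. 13] -/
theorem forall_mem_shaTwo_primary_eq_zero_complex [Finite (W.selmerGroupPInfty p)]
    (hΓ : ∀ Q : W.geomPrimaryTorsion p,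
      (∀ σ : absoluteGaloisGroup K, LocBridge.primaryGaloisModule W p σ Q = Q) → Q = 0) :
    ∀ c ∈ shaTwo (LocBridge.primaryGaloisModule W p), c = 0 :=
  forall_mem_shaTwo_primary_eq_zero_of_isTotallyComplex W p (SignedEC.PoitouTateShaRat.poitouTate_sha_tateDual_numberField K)
    hΓ

/-- **`Ш²(K, E[p^∞]) = ⊥`, `K` totally complex, every `p`, `Sel_{p^∞}(E/K)` finite, `E(K)[p] = 0` — UNCONDITIONAL.**
[cite: MilneADT2006, Ch. I, Thm. 4.10 (a), Thm. 6.13 (c)] -/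
theorem shaTwo_primary_eq_bot_complex [Finite (W.selmerGroupPInfty p)] (hK : ∀ P : W.toAffine.Point, p • P = 0 → P = 0) :
    shaTwo (LocBridge.primaryGaloisModule W p) = ⊥ :=
  shaTwo_primary_eq_bot_of_isTotallyComplex W p (SignedEC.PoitouTateShaRat.poitouTate_sha_tateDual_numberField K) hK

variable (κ : ZpExtension K p) {γ : absoluteGaloisGroup K}

/-- **DIV over a totally complex number field, every prime — UNCONDITIONAL**: for every `ℤ_p`-extension `κ` of `K`,
topological generator `γ`, and elliptic `W/K` with `Sel_{p^∞}(E/K)` finite and `E(K)[p] = 0`, every class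
`s ∈ H¹(Gal(K̄/K_∞), E[p^∞])` is `conj_γ t − t`. [cite: GreenbergLNM1716, §4 Appendix Prop. 4.10, Prop. 4.12 (pp. 116–119)]
[cite: MilneADT2006, Ch. I, Thm. 4.10 (a)] -/
theorem forall_exists_conjH1_sub_eq_complex (hγ : κ.IsTopGenerator γ) [Finite (W.selmerGroupPInfty p)]
    (hK : ∀ P : W.toAffine.Point, p • P = 0 → P = 0) (s : W.subgroupH1 p κ.kerSubgroup) :
    ∃ t : W.subgroupH1 p κ.kerSubgroup, W.conjH1 p κ.kerSubgroup γ t - t = s :=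
  forall_exists_conjH1_sub_eq_of_isTotallyComplex W p κ hγ (SignedEC.PoitouTateShaRat.poitouTate_sha_tateDual_numberField K)
    hK s

/-- **No nonzero finite `Λ`-submodule in the Pontryagin dual of `H¹(K_∞, E[p^∞])`, `K` totally complex, every prime —
UNCONDITIONAL** (Greenberg's Prop. 4.9 / 4.12 conclusion for the full group, `Sel_{p^∞}(E/K)` finite, `E(K)[p] = 0`).
[cite: GreenbergLNM1716, §4 Appendix Prop. 4.9 (p. 113), Prop. 4.12 (p. 119)] [cite: Washington1997, §13.2] -/
theorem dual_forall_finite_eq_bot_complex (hγ : κ.IsTopGenerator γ) [Finite (W.selmerGroupPInfty p)]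
    (hK : ∀ P : W.toAffine.Point, p • P = 0 → P = 0)
    {Y : Type*} [AddCommGroup Y] [Module (IwasawaAlgebra p) Y]
    (dY : Y →+ (W.subgroupH1 p κ.kerSubgroup →+ AddCircle (1 : ℚ))) (hinj : Function.Injective dY)
    (hT : ∀ (y : Y) (x : W.subgroupH1 p κ.kerSubgroup),
      dY ((PowerSeries.X : IwasawaAlgebra p) • y) x = dY y (W.conjH1 p κ.kerSubgroup γ x) - dY y x) :
    ∀ N : Submodule (IwasawaAlgebra p) Y, Finite N → N = ⊥ :=
  dual_forall_finite_eq_bot_of_isTotallyComplex W p κ hγ (SignedEC.PoitouTateShaRat.poitouTate_sha_tateDual_numberField K)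
    hK dY hinj hT

end TotallyComplex

end Summit.BirchSwinnertonDyer.BirchSwinnertonDyer.Theorems.SignedEC.PrimaryTorsionH2

end
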